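import Summits.NavierStokesRegularity.NavierStokesRegularity.Theorems.QuantisedSymmetryPolyhedralDssProfileExistsStubSmoothRepresentativeAe
import Literature.Analysis.FluidPDE.KNSSThm53OfWindow
import HarnessLib

/-!
# No axisymmetric sector on the crux — crux stmt-NavierStokesRegularity-1404
  (`QuantisedSymmetry.PolyhedralDssProfileExists`), line polyhedral_cell, stub stub_notAxisymmetric (N7)

Registered stub `stub_notAxisymmetric` (`--supports stmt-NavierStokesRegularity-1404`), a NECESSARY
CONDITION on witnesses of the crux X⁻, stated on the crux's own variables and symmetry-free:
Koch–Nadirashvili–Seregin–Šverák 2009, Theorem 5.3 — an ancient mild solution `u` of 3-D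
Navier–Stokes in the tree's duality form (`IsAncientMildSolution 1 u`, measurable slices) obeying
the Type-I bound `‖u(t, x)‖ ≤ C₀/(‖x‖ + √(−t))` (`HasTypeIDecay C₀ u`) whose negative slices are
a.e. axisymmetric about the `x₃`-axis (`u(t, R_θ x) = R_θ u(t, x)` for a.e. `x`, every `θ`, every
`t < 0`) has all its negative slices a.e. zero.  Hence the symmetry group of a witness of the crux
cannot contain the rotations about an axis: axisymmetric sectors are forbidden.

Proof (assembly of landed tree theorems).
1. `stub_smoothRepresentative_ae` (p156260): the Oseen-gauge representative `V` of `u`,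
   `IsTypeIAncientMild C V`, `HasTypeIDecay C₀ V`, `V t = u t` a.e. for every `t < 0`.
2. Axisymmetry passes to `V`: the a.e. identity at time `s < 0` is transported along
   `V s = u s` a.e. through the measure-preserving rotation `R_θ` (`measurePreserving_rotZ`), and
   both sides are continuous (`IsTypeIAncientMild.continuous_slice`, `rotZLIE`), so `V s` is
   pointwise axisymmetric (`Measure.eq_of_ae_eq`).
3. For `δ > 0` the shift `s ↦ V (s − δ)` is a bounded ancient mild solution
   (`IsTypeIAncientMild.isBoundedAncientMildSolution_sub`) with continuous (hence measurable)
   axisymmetric slices and `r ‖V(s − δ, x)‖ ≤ ‖x‖ · C₀/(‖x‖ + √(δ − s)) ≤ C₀`.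
4. The DISCHARGED duality-form Theorem 5.3 `knss_bound_C_over_r_holds` kills the shift on every
   negative slice; with `δ = −t/2` and the slice `s = t/2` this is `V t = 0` a.e., and
   `u t = V t = 0` a.e.
-/

noncomputable section

-- the summit namespace `…NavierStokesRegularity.NavierStokesRegularity…` is the tree convention (D-0017)
set_option linter.dupNamespace false

namespace Summit.NavierStokesRegularity.NavierStokesRegularity.Theorems.PolyhedralDssProfileExists.PolyhedralCell

open MeasureTheory Set Function Filter Topology
open Literature.Analysis Literature.Analysis.FluidPDE

/-- **A.e. axisymmetry of a slice passes to a continuous representative as pointwise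
axisymmetry**: if `V = v` a.e., `v (R_θ ·) = R_θ (v ·)` a.e. for every `θ`, and `V` is
continuous, then `V` is axisymmetric — transport the a.e. identity through the measure-preserving
rotation `R_θ` and compare two continuous functions which agree a.e. [folklore] -/
theorem notAxisym_isAxisymmetric_of_ae
    {V v : EuclideanSpace ℝ (Fin 3) → EuclideanSpace ℝ (Fin 3)} (hV : Continuous V)
    (hae : V =ᵐ[volume] v)
    (haxi : ∀ θ : ℝ, (fun x => v (rotZ θ x)) =ᵐ[volume] fun x => rotZ θ (v x)) :
    IsAxisymmetric V := by
  intro θ x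
  have hrot : Continuous (rotZ θ) := (rotZLIE θ).continuous
  -- `V ∘ R_θ = v ∘ R_θ` a.e. (the rotation preserves Lebesgue measure)
  have h1 : (fun y => V (rotZ θ y)) =ᵐ[volume] fun y => v (rotZ θ y) :=
    (measurePreserving_rotZ θ).quasiMeasurePreserving.ae_eq hae
  -- `R_θ ∘ v = R_θ ∘ V` a.e.
  have h2 : (fun y => rotZ θ (v y)) =ᵐ[volume] fun y => rotZ θ (V y) :=
    hae.symm.fun_comp (rotZ θ)
  have h3 : (fun y => V (rotZ θ y)) =ᵐ[volume] fun y => rotZ θ (V y) :=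
    (h1.trans (haxi θ)).trans h2
  have h4 : (fun y => V (rotZ θ y)) = fun y => rotZ θ (V y) :=
    Measure.eq_of_ae_eq h3 (hV.comp hrot) (hrot.comp hV)
  exact congrFun h4 x

/-- **REGISTERED NECESSARY CONDITION `stub_notAxisymmetric` (N7): no axisymmetric sector on the
crux (KNSS 2009, Theorem 5.3, on the crux's own variables).** Every ancient mild solution `u`
(duality form `IsAncientMildSolution 1 u`, measurable slices) with the Type-I bound
`‖u(t, x)‖ ≤ C₀/(‖x‖ + √(−t))` whose negative slices are a.e. axisymmetric about the `x₃`-axis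
has `u t = 0` a.e. for every `t < 0`. Proof: the Oseen-gauge representative `V`
(`stub_smoothRepresentative_ae`) is pointwise axisymmetric on the past
(`notAxisym_isAxisymmetric_of_ae`); its shift `s ↦ V(s − δ)`, `δ = −t/2 > 0`, is a bounded
ancient mild solution (`IsTypeIAncientMild.isBoundedAncientMildSolution_sub`) with continuous
axisymmetric slices and `r ‖V‖ ≤ ‖x‖ · C₀/(‖x‖ + √(δ − s)) ≤ C₀`, so the discharged
duality-form Theorem 5.3 `knss_bound_C_over_r_holds` gives `V(s − δ) = 0` a.e. for every `s < 0`;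
at `s = t/2` this is `V t = 0` a.e., and `u t = V t` a.e. [cite: KochNadirashviliSereginSverak2009, Thm 5.3] -/
theorem stub_notAxisymmetric :
    ∀ (u : ℝ → EuclideanSpace ℝ (Fin 3) → EuclideanSpace ℝ (Fin 3)) (C₀ : ℝ),
      IsAncientMildSolution 1 u → (∀ t < 0, AEStronglyMeasurable (u t) volume) → HasTypeIDecay C₀ u →
      (∀ θ : ℝ, ∀ t < 0, (fun x => u t (rotZ θ x)) =ᵐ[volume] fun x => rotZ θ (u t x)) →
      ∀ t < 0, u t =ᵐ[volume] 0 := by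
  intro u C₀ hanc hmeas hdec haxi t ht
  -- (1) the Oseen-gauge representative
  obtain ⟨V, C, hV, hdecV, hae, -⟩ := stub_smoothRepresentative_ae u C₀ hanc hmeas hdec
  -- (2) the representative is pointwise axisymmetric on the past
  have haxiV : ∀ s < 0, IsAxisymmetric (V s) := fun s hs =>
    notAxisym_isAxisymmetric_of_ae (hV.continuous_slice hs) (hae s hs) fun θ => haxi θ s hs
  -- (3) the shift by `δ = -t/2 > 0` is a bounded ancient mild solution with axisymmetric
  -- continuous slices and `r ‖V‖ ≤ C₀`
  set δ : ℝ := -t / 2 with hδ_def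
  have hδ : 0 < δ := by rw [hδ_def]; linarith
  have hVδ : IsBoundedAncientMildSolution 1 (fun s => V (s - δ)) :=
    hV.isBoundedAncientMildSolution_sub hδ
  have hmeasδ : ∀ s < 0, AEStronglyMeasurable ((fun s => V (s - δ)) s) volume :=
    fun s hs => hV.aestronglyMeasurable_slice (by linarith)
  have haxiδ : ∀ s < 0, IsAxisymmetric ((fun s => V (s - δ)) s) :=
    fun s hs => haxiV (s - δ) (by linarith)
  have hbdδ : ∃ C' : ℝ, ∀ s < 0, ∀ x, cylRadius x * ‖(fun s => V (s - δ)) s x‖ ≤ C' := by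
    refine ⟨C₀, fun s hs x => ?_⟩
    -- `r ‖V(s - δ, x)‖ ≤ (‖x‖ + √(δ - s)) · C₀/(‖x‖ + √(δ - s)) = C₀`
    have hD : 0 < ‖x‖ + √(-(s - δ)) :=
      add_pos_of_nonneg_of_pos (norm_nonneg _) (Real.sqrt_pos.2 (by linarith))
    have hrD : cylRadius x ≤ ‖x‖ + √(-(s - δ)) :=
      (SereginSverak2009.cylRadius_le_norm' x).trans (le_add_of_nonneg_right (Real.sqrt_nonneg _))
    calc cylRadius x * ‖V (s - δ) x‖ ≤ (‖x‖ + √(-(s - δ))) * ‖V (s - δ) x‖ :=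
          mul_le_mul_of_nonneg_right hrD (norm_nonneg _)
      _ ≤ (‖x‖ + √(-(s - δ))) * (C₀ / (‖x‖ + √(-(s - δ)))) :=
          mul_le_mul_of_nonneg_left (hdecV (s - δ) (by linarith) x) hD.le
      _ = C₀ := mul_div_cancel₀ _ hD.ne'
  -- (4) KNSS 2009, Theorem 5.3 (duality form, discharged) kills the shift on every negative slice
  have key : (fun s => V (s - δ)) (t / 2) =ᵐ[volume] 0 :=
    knss_bound_C_over_r_holds hVδ hmeasδ haxiδ hbdδ (t / 2) (by linarith)
  have e : t / 2 - δ = t := by rw [hδ_def]; ring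
  have hVt : V t =ᵐ[volume] 0 := by simpa only [e] using key
  exact (hae t ht).symm.trans hVt

end Summit.NavierStokesRegularity.NavierStokesRegularity.Theorems.PolyhedralDssProfileExists.PolyhedralCell

end
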